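import Mathlib
import Summits.CriticalPhenomena.PercolationContinuityZ3.Theorems.PercNearOneGluingNearOneGluingMaxattOfGl3
import Summits.CriticalPhenomena.PercolationContinuityZ3.Theorems.PercNearOneGluingNearOneGluingMaxattGlue
import Summits.CriticalPhenomena.PercolationContinuityZ3.Theorems.PercNearOneGluingNearOneGluingMaxattTwo
import Literature.Probability.LatticeModels.ProdBernoulliIndependence
import Literature.Probability.Percolation.PercolationEvents
import Literature.Probability.Percolation.Crossings
import HarnessLib

/-!
# RESCUE implies MAXATT

Stub `stub_maxattOfRescue` of line `SketchR2I5` (cycle 4) for the crux `PercNearOneGluing.NearOneGluing`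
(item stmt-CriticalPhenomena-4574 = Kozma–Nitzan Conjecture 3 over all finite weighted graphs).

Setting: one finite weighted graph — vertices `Fin n`, weights `w`, `μ = prodBernoulli w` on bond
configurations `ω : Set (Sym2 (Fin n))`; relay set `A`, source `o ∉ A`, target `b ∈ A`;
`u(a) := μ(a ↮ b) = μ.real (openConn a b)ᶜ`; attachment events `Att a := openConnIn (insert a (↑A)ᶜ) o a`;
lexicographic selection events `Sel_T a := Att a ∩ {every attached a' ∈ T has (u a', a') ≤ₗₑₓ (u a, a)}`
for a family `T`.

* HYPOTHESIS (`stub_rescue`, "RESCUE", verbatim): for `o, b ∉ A'` (pockets avoid `insert b A'`),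
  `Alive := ⋃_{a ∈ A'} {a ↔ b}`, `g a := {a ↮ b} ∩ Alive`:
  `Σ_{a ∈ A'} μ(Sel_{A'} a ∩ g a) ≤ Σ_{a ∈ A'} μ(Sel_{A'} a) μ(g a)`.
* CONCLUSION (`stub_maxattGluing`, "MAXATT", verbatim): for `o ∉ A ∋ b`,
  `μ{o ↮ b ∧ ∃ a ∈ A, Att a} ≤ Σ_{a ∈ A} u(a) μ(Sel_A a)`.

Proof.  Put `A₀ := A.erase b` (`insert b A₀ = A`, so RESCUE for `A₀` speaks about MAXATT's attachment
events), `Z := {∃ a ∈ A₀, Att a}`, `Alive := ⋃_{a ∈ A₀} {a ↔ b}`.  Since `Att b ⊆ {o ↔ b}`, the bad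
event is `Z ∖ {o ↔ b}`; on `Att a` one has `o ↔ b ⟺ a ↔ b`, and the selection events `Sel_{A₀} a`
partition `Z` (`maxattOfGl3_real_setOf_exists_eq_sum`), so
`μ(Z ∩ {o ↔ b}) = Σ_a μ(Sel a ∩ {a ↔ b}) = μ(Z ∩ Alive) − Σ_a μ(Sel a ∩ g a)` and
`Σ_a u(a) μ(Sel a) = μ(Z) − μ(Z) μ(Alive) + Σ_a μ(Sel a) μ(g a)` (`{a ↔ b} ⊔ g a = Alive`).  Harris
(`Z`, `Alive` increasing) and RESCUE give `bad ≤ Σ_{a ∈ A₀} u(a) μ(Sel_{A₀} a)`, and finally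
`Sel_{A₀} a ⊆ Sel_A a` whenever `u(a) > 0` (`u(b) = 0`), while the `b`-term of MAXATT's right side vanishes
(`maxattOfRescue_bookkeeping`).
-/

namespace Summit.CriticalPhenomena.PercolationContinuityZ3.Theorems

open MeasureTheory Set Literature.Probability.LatticeModels Literature.Probability.Percolation
open scoped Classical BigOperators

section MaxattOfRescue

/-- **The lexicographic selection events partition the attachment event, relative version.**  For every
event `T`, `μ({∃ a ∈ A, Att a} ∩ T) = Σ_{a ∈ A} μ(Sel a ∩ T)` with
`Sel a := Att a ∩ {∀ a' ∈ A, Att a' → (u a' < u a ∨ (u a' = u a ∧ a' ≤ a))}`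
(`maxattOfGl3_real_setOf_exists_eq_sum` for the restricted measure `μ|_T`). -/
theorem maxattOfRescue_real_inter_eq_sum {Ω α : Type*} [MeasurableSpace Ω] [DiscreteMeasurableSpace Ω]
    [LinearOrder α] (μ : Measure Ω) [IsFiniteMeasure μ] (A : Finset α) (Att : α → Set Ω) (u : α → ℝ)
    (T : Set Ω) :
    μ.real ({ω : Ω | ∃ a ∈ A, ω ∈ Att a} ∩ T) =
      ∑ a ∈ A, μ.real ({ω : Ω | ω ∈ Att a ∧
        ∀ a' ∈ A, ω ∈ Att a' → (u a' < u a ∨ (u a' = u a ∧ a' ≤ a))} ∩ T) := by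
  have h := maxattOfGl3_real_setOf_exists_eq_sum (μ.restrict T) A Att u
  simpa only [measureReal_restrict_apply MeasurableSet.of_discrete] using h

/-- **Measure bookkeeping for RESCUE ⟹ MAXATT** (abstract form: any discrete finite measure space, events
`Att a` "attached", `B a` "`a ↔ b`", `Bo` "`o ↔ b`", `u a = 1 - μ(B a)`, a family `Sel a` partitioning
`{∃ a ∈ A.erase b, Att a}` with `Sel a ⊆ Att a`, and MAXATT's selection events `SelA a ⊇ Sel a` whenever
`u a > 0`).  Given `u b = 0`, `Att b ⊆ Bo`, `Bo = B a` on `Att a`, Harris for `{∃ a ∈ A.erase b, Att a}` and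
`⋃_{a ∈ A.erase b} B a`, and the RESCUE inequality for `A.erase b`, the MAXATT inequality for `A` follows:
`μ{ω ∉ Bo ∧ ∃ a ∈ A, Att a} ≤ Σ_{a ∈ A} u(a) μ(SelA a)`. -/
theorem maxattOfRescue_bookkeeping {Ω α : Type*} [MeasurableSpace Ω] [DiscreteMeasurableSpace Ω]
    [DecidableEq α] (μ : Measure Ω) [IsFiniteMeasure μ] (A : Finset α) (b : α) (Att B Sel SelA : α → Set Ω)
    (Bo : Set Ω) (u : α → ℝ) (hb : b ∈ A) (hu : ∀ a, μ.real (B a) = 1 - u a) (hu0 : ∀ a, 0 ≤ u a)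
    (hub : u b = 0) (hAttb : Att b ⊆ Bo) (hXo : ∀ a, ∀ ω ∈ Att a, ω ∈ Bo ↔ ω ∈ B a)
    (hSelAtt : ∀ a ∈ A.erase b, Sel a ⊆ Att a) (hSelA : ∀ a ∈ A.erase b, 0 < u a → Sel a ⊆ SelA a)
    (hpart : ∀ T : Set Ω, μ.real ({ω | ∃ a ∈ A.erase b, ω ∈ Att a} ∩ T) =
      ∑ a ∈ A.erase b, μ.real (Sel a ∩ T))
    (hharris : μ.real {ω | ∃ a ∈ A.erase b, ω ∈ Att a} * μ.real (⋃ a ∈ A.erase b, B a) ≤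
      μ.real ({ω | ∃ a ∈ A.erase b, ω ∈ Att a} ∩ ⋃ a ∈ A.erase b, B a))
    (hres : ∑ a ∈ A.erase b, μ.real (Sel a ∩ ((B a)ᶜ ∩ ⋃ a' ∈ A.erase b, B a')) ≤
      ∑ a ∈ A.erase b, μ.real (Sel a) * μ.real ((B a)ᶜ ∩ ⋃ a' ∈ A.erase b, B a')) :
    μ.real {ω | ω ∉ Bo ∧ ∃ a ∈ A, ω ∈ Att a} ≤ ∑ a ∈ A, u a * μ.real (SelA a) := by
  have hm : ∀ s : Set Ω, MeasurableSet s := fun s => MeasurableSet.of_discrete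
  -- (i) the bad event: an attached relay of a bad configuration lies in `A.erase b` (`Att b ⊆ Bo`)
  have hbad_eq : {ω | ω ∉ Bo ∧ ∃ a ∈ A, ω ∈ Att a} =
      {ω | ∃ a ∈ A.erase b, ω ∈ Att a} \ ({ω | ∃ a ∈ A.erase b, ω ∈ Att a} ∩ Bo) := by
    ext ω
    simp only [Set.mem_setOf_eq, Set.mem_sdiff, Set.mem_inter_iff]
    constructor
    · rintro ⟨hBo, a, ha, hω⟩
      have hab : a ≠ b := by
        rintro rfl
        exact hBo (hAttb hω)
      exact ⟨⟨a, Finset.mem_erase.2 ⟨hab, ha⟩, hω⟩, fun h => hBo h.2⟩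
    · rintro ⟨⟨a, ha, hω⟩, hnot⟩
      exact ⟨fun hBo => hnot ⟨⟨a, ha, hω⟩, hBo⟩, a, Finset.mem_of_mem_erase ha, hω⟩
  have hbad : μ.real {ω | ω ∉ Bo ∧ ∃ a ∈ A, ω ∈ Att a} =
      μ.real {ω | ∃ a ∈ A.erase b, ω ∈ Att a} - μ.real ({ω | ∃ a ∈ A.erase b, ω ∈ Att a} ∩ Bo) := by
    rw [hbad_eq, measureReal_sdiff Set.inter_subset_left (hm _)]
  -- (ii) the selection events partition `Z`, `Z ∩ Bo` and `Z ∩ Alive`; on `Sel a`, `Bo = B a`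
  have hP1 : μ.real {ω | ∃ a ∈ A.erase b, ω ∈ Att a} = ∑ a ∈ A.erase b, μ.real (Sel a) := by
    have h := hpart Set.univ
    simpa only [Set.inter_univ] using h
  have hP2 : μ.real ({ω | ∃ a ∈ A.erase b, ω ∈ Att a} ∩ Bo) =
      ∑ a ∈ A.erase b, μ.real (Sel a ∩ B a) := by
    rw [hpart Bo]
    refine Finset.sum_congr rfl fun a ha => ?_
    have hset : Sel a ∩ Bo = Sel a ∩ B a := by
      ext ω
      exact ⟨fun h => ⟨h.1, (hXo a ω (hSelAtt a ha h.1)).1 h.2⟩,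
        fun h => ⟨h.1, (hXo a ω (hSelAtt a ha h.1)).2 h.2⟩⟩
    rw [hset]
  have hP3 := hpart (⋃ a ∈ A.erase b, B a)
  -- (iii) `B a ⊆ Alive` for `a ∈ A.erase b`: split `Sel a ∩ Alive` and `Alive` along `B a`
  have hBAl : ∀ a ∈ A.erase b, B a ⊆ ⋃ a' ∈ A.erase b, B a' := fun a ha =>
    Set.subset_biUnion_of_mem (u := fun a' => B a') ha
  have hQ : ∀ a ∈ A.erase b, μ.real (Sel a ∩ ⋃ a' ∈ A.erase b, B a') =
      μ.real (Sel a ∩ B a) + μ.real (Sel a ∩ ((B a)ᶜ ∩ ⋃ a' ∈ A.erase b, B a')) := by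
    intro a ha
    rw [← measureReal_inter_add_sdiff (hm (B a)) (s := Sel a ∩ ⋃ a' ∈ A.erase b, B a')
      (measure_ne_top _ _)]
    have h1 : (Sel a ∩ ⋃ a' ∈ A.erase b, B a') ∩ B a = Sel a ∩ B a := by
      rw [Set.inter_assoc, Set.inter_eq_right.2 (hBAl a ha)]
    have h2 : (Sel a ∩ ⋃ a' ∈ A.erase b, B a') \ B a = Sel a ∩ ((B a)ᶜ ∩ ⋃ a' ∈ A.erase b, B a') := by
      rw [Set.sdiff_eq_compl_inter, Set.inter_left_comm]
    rw [h1, h2]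
  have hR : ∀ a ∈ A.erase b, μ.real (⋃ a' ∈ A.erase b, B a') =
      μ.real (B a) + μ.real ((B a)ᶜ ∩ ⋃ a' ∈ A.erase b, B a') := by
    intro a ha
    rw [← measureReal_inter_add_sdiff (hm (B a)) (s := ⋃ a' ∈ A.erase b, B a') (measure_ne_top _ _),
      Set.inter_eq_right.2 (hBAl a ha), Set.sdiff_eq_compl_inter]
  -- (iv) the estimate `bad ≤ Σ_{a ∈ A.erase b} u a μ(Sel a)` (Harris + RESCUE)
  have hsumB : ∑ a ∈ A.erase b, μ.real (Sel a ∩ B a) =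
      ∑ a ∈ A.erase b, μ.real (Sel a ∩ ⋃ a' ∈ A.erase b, B a') -
        ∑ a ∈ A.erase b, μ.real (Sel a ∩ ((B a)ᶜ ∩ ⋃ a' ∈ A.erase b, B a')) := by
    rw [← Finset.sum_sub_distrib]
    refine Finset.sum_congr rfl fun a ha => ?_
    rw [hQ a ha]
    ring
  have hsumU : ∑ a ∈ A.erase b, u a * μ.real (Sel a) =
      μ.real {ω | ∃ a ∈ A.erase b, ω ∈ Att a} -
          μ.real {ω | ∃ a ∈ A.erase b, ω ∈ Att a} * μ.real (⋃ a' ∈ A.erase b, B a') +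
        ∑ a ∈ A.erase b, μ.real (Sel a) * μ.real ((B a)ᶜ ∩ ⋃ a' ∈ A.erase b, B a') := by
    rw [hP1, Finset.sum_mul, ← Finset.sum_sub_distrib, ← Finset.sum_add_distrib]
    refine Finset.sum_congr rfl fun a ha => ?_
    have h1 := hu a
    have h2 := hR a ha
    have h3 : u a = 1 - μ.real (⋃ a' ∈ A.erase b, B a') +
        μ.real ((B a)ᶜ ∩ ⋃ a' ∈ A.erase b, B a') := by linarith
    rw [h3]
    ring
  have hbound : μ.real {ω | ω ∉ Bo ∧ ∃ a ∈ A, ω ∈ Att a} ≤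
      ∑ a ∈ A.erase b, u a * μ.real (Sel a) := by
    rw [hbad, hsumU, hP2, hsumB, ← hP3]
    linarith [hharris, hres]
  -- (v) comparison with MAXATT's right side
  have hcomp : ∀ a ∈ A.erase b, u a * μ.real (Sel a) ≤ u a * μ.real (SelA a) := by
    intro a ha
    rcases (hu0 a).eq_or_lt with hua | hua
    · rw [← hua, zero_mul, zero_mul]
    · exact mul_le_mul_of_nonneg_left (measureReal_mono (hSelA a ha hua) (measure_ne_top _ _)) (hu0 a)
  calc μ.real {ω | ω ∉ Bo ∧ ∃ a ∈ A, ω ∈ Att a}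
      ≤ ∑ a ∈ A.erase b, u a * μ.real (Sel a) := hbound
    _ ≤ ∑ a ∈ A.erase b, u a * μ.real (SelA a) := Finset.sum_le_sum hcomp
    _ = ∑ a ∈ A, u a * μ.real (SelA a) := by
      rw [← Finset.add_sum_erase A _ hb, hub, zero_mul, zero_add]

end MaxattOfRescue

/-- **RESCUE implies MAXATT** (stub `stub_maxattOfRescue` of line `SketchR2I5`, cycle 4).  The hypothesis is
the lead's RESCUE inequality `stub_rescue` verbatim, the conclusion the MAXATT inequality `stub_maxattGluing`
verbatim.  For `o ∉ A ∋ b`: apply RESCUE to `A₀ := A.erase b` (`insert b A₀ = A`, so its attachment and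
selection events are MAXATT's restricted to `A₀`), Harris for `{∃ a ∈ A₀, Att a}` and
`⋃_{a ∈ A₀} {a ↔ b}` (both increasing), and the bookkeeping `maxattOfRescue_bookkeeping` (`Att b ⊆ {o ↔ b}`,
`o ↔ b ⟺ a ↔ b` on `Att a`, `μ(b ↮ b) = 0`, and `Sel_{A₀} a ⊆ Sel_A a` whenever `μ(a ↮ b) > 0`). -/
theorem stub_maxattOfRescue :
    (∀ (n : ℕ) (w : Sym2 (Fin n) → unitInterval) (A : Finset (Fin n)) (o b : Fin n), o ∉ A → b ∉ A →
      ∑ a ∈ A, (prodBernoulli w).real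
          ({ω | ω ∈ openConnIn (insert a ((↑(insert b A) : Set (Fin n))ᶜ)) o a ∧
              ∀ a' ∈ A, ω ∈ openConnIn (insert a' ((↑(insert b A) : Set (Fin n))ᶜ)) o a' →
                ((prodBernoulli w).real (openConn a' b)ᶜ < (prodBernoulli w).real (openConn a b)ᶜ ∨
                  ((prodBernoulli w).real (openConn a' b)ᶜ = (prodBernoulli w).real (openConn a b)ᶜ ∧ a' ≤ a))} ∩
            ((openConn a b)ᶜ ∩ ⋃ a' ∈ A, openConn a' b)) ≤
        ∑ a ∈ A, (prodBernoulli w).real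
            {ω | ω ∈ openConnIn (insert a ((↑(insert b A) : Set (Fin n))ᶜ)) o a ∧
              ∀ a' ∈ A, ω ∈ openConnIn (insert a' ((↑(insert b A) : Set (Fin n))ᶜ)) o a' →
                ((prodBernoulli w).real (openConn a' b)ᶜ < (prodBernoulli w).real (openConn a b)ᶜ ∨
                  ((prodBernoulli w).real (openConn a' b)ᶜ = (prodBernoulli w).real (openConn a b)ᶜ ∧ a' ≤ a))} *
          (prodBernoulli w).real ((openConn a b)ᶜ ∩ ⋃ a' ∈ A, openConn a' b)) →
    (∀ (n : ℕ) (w : Sym2 (Fin n) → unitInterval) (A : Finset (Fin n)) (o b : Fin n), o ∉ A → b ∈ A →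
      (prodBernoulli w).real {ω | ω ∉ openConn o b ∧
          ∃ a ∈ A, ω ∈ openConnIn (insert a ((↑A : Set (Fin n))ᶜ)) o a} ≤
        ∑ a ∈ A, (prodBernoulli w).real (openConn a b)ᶜ *
          (prodBernoulli w).real {ω | ω ∈ openConnIn (insert a ((↑A : Set (Fin n))ᶜ)) o a ∧
            ∀ a' ∈ A, ω ∈ openConnIn (insert a' ((↑A : Set (Fin n))ᶜ)) o a' →
              ((prodBernoulli w).real (openConn a' b)ᶜ < (prodBernoulli w).real (openConn a b)ᶜ ∨
                ((prodBernoulli w).real (openConn a' b)ᶜ = (prodBernoulli w).real (openConn a b)ᶜ ∧ a' ≤ a))}) := by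
  intro hRES n w A o b ho hb
  have hm : ∀ s : Set (BondConfig (Fin n)), MeasurableSet s := fun s => MeasurableSet.of_discrete
  -- RESCUE for the family `A.erase b` (`o, b ∉ A.erase b`); its pockets are MAXATT's (`insert b (A.erase b) = A`)
  have hoA₀ : o ∉ A.erase b := fun h => ho (Finset.mem_of_mem_erase h)
  have hres := hRES n w (A.erase b) o b hoA₀ (Finset.notMem_erase b A)
  rw [Finset.insert_erase hb] at hres
  -- `r = 1 - u`, `u b = 0`
  have hu : ∀ a, (prodBernoulli w).real (openConn a b) = 1 - (prodBernoulli w).real (openConn a b)ᶜ := by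
    intro a
    rw [probReal_compl_eq_one_sub (hm _)]
    ring
  have hub : (prodBernoulli w).real (openConn b b : Set (BondConfig (Fin n)))ᶜ = 0 := by
    have hempty : (openConn b b : Set (BondConfig (Fin n)))ᶜ = ∅ :=
      Set.compl_empty_iff.2 (Set.eq_univ_of_forall fun _ => SimpleGraph.Reachable.refl _)
    rw [hempty, measureReal_empty]
  -- pointwise: `Att b ⊆ {o ↔ b}`; on `Att a`, `o ↔ b ⟺ a ↔ b`; `Sel_{A.erase b} a ⊆ Sel_A a` if `u a > 0`
  have hAttb : (openConnIn (insert b ((↑A : Set (Fin n))ᶜ)) o b : Set (BondConfig (Fin n))) ⊆ openConn o b :=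
    fun ω hω => maxattTwo_openConn_of_openConnIn hω
  have hXo : ∀ a, ∀ ω ∈ (openConnIn (insert a ((↑A : Set (Fin n))ᶜ)) o a : Set (BondConfig (Fin n))),
      ω ∈ (openConn o b : Set (BondConfig (Fin n))) ↔ ω ∈ (openConn a b : Set (BondConfig (Fin n))) := by
    intro a ω hω
    have hoa : (openGraph ω).Reachable o a := maxattTwo_openConn_of_openConnIn hω
    exact ⟨fun h => hoa.symm.trans h, fun h => hoa.trans h⟩
  have hSelAtt : ∀ a ∈ A.erase b,
      {ω : BondConfig (Fin n) | ω ∈ openConnIn (insert a ((↑A : Set (Fin n))ᶜ)) o a ∧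
        ∀ a' ∈ A.erase b, ω ∈ openConnIn (insert a' ((↑A : Set (Fin n))ᶜ)) o a' →
          ((prodBernoulli w).real (openConn a' b)ᶜ < (prodBernoulli w).real (openConn a b)ᶜ ∨
            ((prodBernoulli w).real (openConn a' b)ᶜ = (prodBernoulli w).real (openConn a b)ᶜ ∧ a' ≤ a))} ⊆
      openConnIn (insert a ((↑A : Set (Fin n))ᶜ)) o a := fun a _ ω hω => hω.1
  have hSelA : ∀ a ∈ A.erase b, 0 < (prodBernoulli w).real (openConn a b)ᶜ →
      {ω : BondConfig (Fin n) | ω ∈ openConnIn (insert a ((↑A : Set (Fin n))ᶜ)) o a ∧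
        ∀ a' ∈ A.erase b, ω ∈ openConnIn (insert a' ((↑A : Set (Fin n))ᶜ)) o a' →
          ((prodBernoulli w).real (openConn a' b)ᶜ < (prodBernoulli w).real (openConn a b)ᶜ ∨
            ((prodBernoulli w).real (openConn a' b)ᶜ = (prodBernoulli w).real (openConn a b)ᶜ ∧ a' ≤ a))} ⊆
      {ω : BondConfig (Fin n) | ω ∈ openConnIn (insert a ((↑A : Set (Fin n))ᶜ)) o a ∧
        ∀ a' ∈ A, ω ∈ openConnIn (insert a' ((↑A : Set (Fin n))ᶜ)) o a' →
          ((prodBernoulli w).real (openConn a' b)ᶜ < (prodBernoulli w).real (openConn a b)ᶜ ∨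
            ((prodBernoulli w).real (openConn a' b)ᶜ = (prodBernoulli w).real (openConn a b)ᶜ ∧ a' ≤ a))} := by
    rintro a - hua ω ⟨hatt, hsel⟩
    refine ⟨hatt, fun a' ha' hω' => ?_⟩
    by_cases hab : a' = b
    · left
      rw [hab, hub]
      exact hua
    · exact hsel a' (Finset.mem_erase.2 ⟨hab, ha'⟩) hω'
  -- the selection events partition the attachment event (relative to any event `T`)
  have hpart := fun T : Set (BondConfig (Fin n)) => maxattOfRescue_real_inter_eq_sum (prodBernoulli w)
    (A.erase b) (fun a => (openConnIn (insert a ((↑A : Set (Fin n))ᶜ)) o a : Set (BondConfig (Fin n))))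
    (fun a => (prodBernoulli w).real (openConn a b)ᶜ) T
  -- Harris for `Z = {∃ a ∈ A.erase b, Att a}` and `Alive = ⋃_{a ∈ A.erase b} {a ↔ b}` (both increasing)
  have hZ : IsUpperSet {ω : BondConfig (Fin n) | ∃ a ∈ A.erase b,
      ω ∈ openConnIn (insert a ((↑A : Set (Fin n))ᶜ)) o a} :=
    fun ω ω' hle ⟨a, ha, hω⟩ => ⟨a, ha, isUpperSet_openConnIn _ o a hle hω⟩
  have hAl : IsUpperSet (⋃ a ∈ A.erase b, (openConn a b : Set (BondConfig (Fin n)))) :=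
    isUpperSet_iUnion₂ fun a _ => isUpperSet_openConn a b
  have hharris := prodBernoulli_harris w hZ hAl (hm _) (hm _)
  exact maxattOfRescue_bookkeeping (prodBernoulli w) A b
    (fun a => openConnIn (insert a ((↑A : Set (Fin n))ᶜ)) o a) (fun a => openConn a b)
    (fun a => {ω : BondConfig (Fin n) | ω ∈ openConnIn (insert a ((↑A : Set (Fin n))ᶜ)) o a ∧
      ∀ a' ∈ A.erase b, ω ∈ openConnIn (insert a' ((↑A : Set (Fin n))ᶜ)) o a' →
        ((prodBernoulli w).real (openConn a' b)ᶜ < (prodBernoulli w).real (openConn a b)ᶜ ∨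
          ((prodBernoulli w).real (openConn a' b)ᶜ = (prodBernoulli w).real (openConn a b)ᶜ ∧ a' ≤ a))})
    (fun a => {ω : BondConfig (Fin n) | ω ∈ openConnIn (insert a ((↑A : Set (Fin n))ᶜ)) o a ∧
      ∀ a' ∈ A, ω ∈ openConnIn (insert a' ((↑A : Set (Fin n))ᶜ)) o a' →
        ((prodBernoulli w).real (openConn a' b)ᶜ < (prodBernoulli w).real (openConn a b)ᶜ ∨
          ((prodBernoulli w).real (openConn a' b)ᶜ = (prodBernoulli w).real (openConn a b)ᶜ ∧ a' ≤ a))})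
    (openConn o b) (fun a => (prodBernoulli w).real (openConn a b)ᶜ) hb hu (fun a => measureReal_nonneg) hub
    hAttb hXo hSelAtt hSelA hpart hharris hres

end Summit.CriticalPhenomena.PercolationContinuityZ3.Theorems
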